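import Summits.CriticalPhenomena.PercolationContinuityZ3.Theorems.PercNearOneGluingNoHeavyLowerTailSahiOneStepSubblockLayer
import Summits.CriticalPhenomena.PercolationContinuityZ3.Theorems.PercNearOneGluingNoHeavyLowerTailSahiOneStepSubblockGrid
import Summits.CriticalPhenomena.PercolationContinuityZ3.Theorems.PercNearOneGluingNoHeavyLowerTailSahiOneStepCone
import Summits.CriticalPhenomena.PercolationContinuityZ3.Theorems.PercNearOneGluingNoHeavyLowerTailSahiOneStepFibreThresholdAll
import HarnessLib

/-!
# One-step scheme: `(2′)` FOR EVERY SUB-BLOCK THRESHOLD, and Kahn C5 / Sahi `C₃` for two nested-block thresholds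

Prover prim-ineq-prove-3 gen 20 (`--supports stmt-CriticalPhenomena-4575`; memo `run/shared/lean/prim/prim-ineq-prove-3/FINDING-G20-COUPLING-SPLIT.md`
§2, THEOREM A).  No definitions, no named facts, no sorries, no `native_decide`.

* `osN_subblockThreshold_nonneg` — **hypothesis `(2′)` of the one-step scheme holds for the pair (`U`, `{N_T ≥ r}`)**: for every product
  measure, every block `F`, every `T ⊆ F`, all `t, r`, and EVERY increasing event `U ⊆ 2^ι`,
  `0 ≤ osN p {N_F ≥ t} 1_U 1_{N_T ≥ r}`, i.e. `Cov(U, B) ≥ μ(N_F < t)·Cov(U, B ∣ N_F < t)` for the sub-block threshold `B = {N_T ≥ r}`.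
  Proof: the cells `{N_T = k} ∩ {N_{F∖T} = j}` turn the statement into the grid theorem `…SubblockGrid.grid_osN_nonneg`, whose row/column
  monotonicity hypotheses are `…SubblockLayer.real_inter_inter_layer_mul_le` (layer monotonicity with a foreign factor).
* `sahiE3_threshold_subblockThreshold_nonneg` — **Kahn C5 / Sahi `C₃` for every triple {`Th_t(F)`, `Th_r(T)`, `U`} with `T ⊆ F` and `U`
  increasing**: `0 ≤ E₃(1_{N_F ≥ t}, 1_U, 1_{N_T ≥ r})`, by `E₃ = m′ + n` (`osT_eq_osMp_add_osN`), gen 17's `osMp_threshold_nonneg_all` and the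
  first bullet (and the two slot-exchanged forms).  Previously in the kernel only for `|F| ≤ 5` (computational lane), `t ≤ 2`, `t = |F|`, or a principal
  middle slot; here `F`, `T ⊆ F`, `t`, `r` are arbitrary.
-/

noncomputable section

namespace Summit.CriticalPhenomena.PercolationContinuityZ3.Theorems

namespace SahiOneStep

open MeasureTheory Finset
open Literature.Probability.Percolation (DeterminedBy determinedBy_iff prodBernoulli_real_eq_sum_weight_ind)
open Literature.Probability.LatticeModels (prodBernoulli sahiE3 prodBernoulli_real_inter_of_determinedBy_disjoint)
open Literature.Probability.Percolation.DecisionTree (ind ind_of_mem ind_of_not_mem ind_nonneg)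
open Literature.Probability.Percolation.BHK2006 (weight weight_nonneg)
open scoped Classical

variable {ι : Type*} [Fintype ι] [DecidableEq ι]

/-! ## Cells `{N_T = k} ∩ {N_R = j}` -/

omit [Fintype ι] in
/-- `N_F = N_T + N_{F∖T}` for `T ⊆ F`. [folklore] -/
theorem card_filter_mem_eq_add (F : Finset ι) {T : Finset ι} (hTF : T ⊆ F) (ω : Set ι) :
    (F.filter (· ∈ ω)).card = (T.filter (· ∈ ω)).card + ((F \ T).filter (· ∈ ω)).card := by
  rw [← Finset.card_union_of_disjoint (Finset.disjoint_filter_filter Finset.disjoint_sdiff), ← Finset.filter_union,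
    Finset.union_sdiff_of_subset hTF]

omit [Fintype ι] [DecidableEq ι] in
/-- Pointwise cell decomposition of an indicator. [folklore] -/
theorem ind_eq_sum_cells (T R : Finset ι) (E : Set (Set ι)) (ω : Set ι) :
    ind E ω = ∑ k ∈ range (T.card + 1), ∑ j ∈ range (R.card + 1),
      ind (E ∩ {ω' : Set ι | (R.filter (· ∈ ω')).card = j} ∩ {ω' : Set ι | (T.filter (· ∈ ω')).card = k}) ω := by
  set k₀ := (T.filter (· ∈ ω)).card with hk₀
  set j₀ := (R.filter (· ∈ ω)).card with hj₀
  have hk₀K : k₀ ∈ range (T.card + 1) := Finset.mem_range.2 (Nat.lt_succ_of_le (Finset.card_filter_le _ _))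
  have hj₀J : j₀ ∈ range (R.card + 1) := Finset.mem_range.2 (Nat.lt_succ_of_le (Finset.card_filter_le _ _))
  rw [Finset.sum_eq_single_of_mem k₀ hk₀K (fun k _ hk => Finset.sum_eq_zero fun j _ => ind_of_not_mem fun h => hk h.2.symm)]
  rw [Finset.sum_eq_single_of_mem j₀ hj₀J (fun j _ hj => ind_of_not_mem fun h => hj h.1.2.symm)]
  by_cases hE : ω ∈ E
  · rw [ind_of_mem hE, ind_of_mem (show ω ∈ E ∩ {ω' : Set ι | (R.filter (· ∈ ω')).card = j₀} ∩
      {ω' : Set ι | (T.filter (· ∈ ω')).card = k₀} from ⟨⟨hE, rfl⟩, rfl⟩)]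
  · rw [ind_of_not_mem hE, ind_of_not_mem fun h => hE h.1.1]

omit [DecidableEq ι] in
/-- **Cell decomposition of a measure**: `μ(E) = Σ_{k,j} μ(E ∩ {N_R = j} ∩ {N_T = k})`. [folklore] -/
theorem real_eq_sum_cells (p : ι → unitInterval) (T R : Finset ι) (E : Set (Set ι)) :
    (prodBernoulli p).real E = ∑ k ∈ range (T.card + 1), ∑ j ∈ range (R.card + 1),
      (prodBernoulli p).real (E ∩ {ω' : Set ι | (R.filter (· ∈ ω')).card = j} ∩ {ω' : Set ι | (T.filter (· ∈ ω')).card = k}) := by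
  simp_rw [prodBernoulli_real_eq_sum_weight_ind]
  calc ∑ ω : Set ι, weight (fun e => (p e : ℝ)) ω * ind E ω
      = ∑ ω : Set ι, ∑ k ∈ range (T.card + 1), ∑ j ∈ range (R.card + 1), weight (fun e => (p e : ℝ)) ω *
          ind (E ∩ {ω' : Set ι | (R.filter (· ∈ ω')).card = j} ∩ {ω' : Set ι | (T.filter (· ∈ ω')).card = k}) ω := by
        refine Finset.sum_congr rfl fun ω _ => ?_
        rw [ind_eq_sum_cells T R E ω, Finset.mul_sum]
        exact Finset.sum_congr rfl fun k _ => Finset.mul_sum _ _ _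
    _ = ∑ k ∈ range (T.card + 1), ∑ ω : Set ι, ∑ j ∈ range (R.card + 1), weight (fun e => (p e : ℝ)) ω *
          ind (E ∩ {ω' : Set ι | (R.filter (· ∈ ω')).card = j} ∩ {ω' : Set ι | (T.filter (· ∈ ω')).card = k}) ω :=
        Finset.sum_comm
    _ = _ := Finset.sum_congr rfl fun k _ => Finset.sum_comm

omit [Fintype ι] [DecidableEq ι] in
/-- **A conditioned cell**: if on the cell `{N_T = k} ∩ {N_R = j}` membership in `C` reads `P ∧ (· ∈ V)`, then
`μ(C ∩ cell) = [P]·μ(V ∩ cell)`. [folklore] -/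
theorem real_inter_cell_eq_ite (p : ι → unitInterval) (T R : Finset ι) {C V : Set (Set ι)} {P : Prop} [Decidable P] {k j : ℕ}
    (hC : ∀ ω : Set ι, (T.filter (· ∈ ω)).card = k → (R.filter (· ∈ ω)).card = j → (ω ∈ C ↔ (P ∧ ω ∈ V))) :
    (prodBernoulli p).real (C ∩ {ω' : Set ι | (R.filter (· ∈ ω')).card = j} ∩ {ω' : Set ι | (T.filter (· ∈ ω')).card = k}) =
      if P then (prodBernoulli p).real (V ∩ {ω' : Set ι | (R.filter (· ∈ ω')).card = j} ∩
        {ω' : Set ι | (T.filter (· ∈ ω')).card = k}) else 0 := by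
  by_cases hP : P
  · rw [if_pos hP]
    congr 1
    ext ω
    simp only [Set.mem_inter_iff, Set.mem_setOf_eq]
    constructor
    · rintro ⟨⟨hω, hj⟩, hk⟩; exact ⟨⟨((hC ω hk hj).1 hω).2, hj⟩, hk⟩
    · rintro ⟨⟨hω, hj⟩, hk⟩; exact ⟨⟨(hC ω hk hj).2 ⟨hP, hω⟩, hj⟩, hk⟩
  · rw [if_neg hP]
    have hempty : C ∩ {ω' : Set ι | (R.filter (· ∈ ω')).card = j} ∩ {ω' : Set ι | (T.filter (· ∈ ω')).card = k} = ∅ := by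
      ext ω
      simp only [Set.mem_inter_iff, Set.mem_setOf_eq, Set.mem_empty_iff_false, iff_false]
      rintro ⟨⟨hω, hj⟩, hk⟩
      exact hP ((hC ω hk hj).1 hω).1
    rw [hempty, measureReal_empty]

omit [DecidableEq ι] in
/-- The cell product: `μ({N_R = j} ∩ {N_T = k}) = μ{N_T = k}·μ{N_R = j}` for disjoint `T, R`. [folklore] -/
theorem real_cell_eq_mul (p : ι → unitInterval) {T R : Finset ι} (hTR : Disjoint T R) (k j : ℕ) :
    (prodBernoulli p).real (Set.univ ∩ {ω' : Set ι | (R.filter (· ∈ ω')).card = j} ∩ {ω' : Set ι | (T.filter (· ∈ ω')).card = k}) =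
      (prodBernoulli p).real {ω' : Set ι | (T.filter (· ∈ ω')).card = k} *
        (prodBernoulli p).real {ω' : Set ι | (R.filter (· ∈ ω')).card = j} := by
  rw [Set.univ_inter, mul_comm]
  exact prodBernoulli_real_inter_of_determinedBy_disjoint p hTR.symm (determinedBy_layer R j) (determinedBy_layer T k)
    MeasurableSet.of_discrete MeasurableSet.of_discrete

/-! ## The grid theorem in `H`-form -/

/-- The conclusion of `grid_osN_nonneg` rewritten with `H = {t ≤ k+j}`-sums (the shape of `osN_ind_ind`). [this work] -/
theorem grid_osN_nonneg_Hform (K J : ℕ) (a b : ℕ → ℝ) (u : ℕ → ℕ → ℝ) (r t : ℕ)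
    (ha : ∀ k, 0 ≤ a k) (hb : ∀ j, 0 ≤ b j) (hu : ∀ k j, 0 ≤ u k j) (hub : ∀ k j, u k j ≤ a k * b j)
    (F1 : ∀ k k' j, k ≤ k' → u k j * a k' ≤ u k' j * a k) (F2 : ∀ k j j', j ≤ j' → u k j * b j' ≤ u k j' * b j)
    (hA1 : ∑ k ∈ range (K + 1), a k = 1) (hB1 : ∑ j ∈ range (J + 1), b j = 1) :
    0 ≤ (∑ k ∈ range (K + 1), ∑ j ∈ range (J + 1), if t ≤ k + j then u k j else 0) *
          (∑ k ∈ range (K + 1), ∑ j ∈ range (J + 1), if t ≤ k + j ∧ r ≤ k then a k * b j else 0)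
        + (1 - ∑ k ∈ range (K + 1), ∑ j ∈ range (J + 1), if t ≤ k + j then a k * b j else 0) *
          (∑ k ∈ range (K + 1), ∑ j ∈ range (J + 1), if t ≤ k + j ∧ r ≤ k then u k j else 0)
        + (∑ k ∈ range (K + 1), ∑ j ∈ range (J + 1), if t ≤ k + j then a k * b j else 0) *
          (∑ k ∈ range (K + 1), ∑ j ∈ range (J + 1), u k j) *
          (∑ k ∈ range (K + 1), ∑ j ∈ range (J + 1), if r ≤ k then a k * b j else 0)
        - (∑ k ∈ range (K + 1), ∑ j ∈ range (J + 1), if t ≤ k + j then u k j else 0) *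
          (∑ k ∈ range (K + 1), ∑ j ∈ range (J + 1), if r ≤ k then a k * b j else 0)
        - (∑ k ∈ range (K + 1), ∑ j ∈ range (J + 1), if t ≤ k + j ∧ r ≤ k then a k * b j else 0) *
          (∑ k ∈ range (K + 1), ∑ j ∈ range (J + 1), u k j) := by
  have hgrid := grid_osN_nonneg K J a b u r t ha hb hu hub F1 F2 hA1 hB1
  -- relate `H`-sums and `L`-sums
  have eSU : (∑ k ∈ range (K + 1), ∑ j ∈ range (J + 1), u k j) =
      (∑ k ∈ range (K + 1), ∑ j ∈ range (J + 1), if t ≤ k + j then u k j else 0) +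
        (∑ k ∈ range (K + 1), ∑ j ∈ range (J + 1), if k + j < t then u k j else 0) := by
    have h1 : (∑ k ∈ range (K + 1), ∑ j ∈ range (J + 1), u k j) =
        ∑ k ∈ range (K + 1), ∑ j ∈ range (J + 1), if True then u k j else 0 := by simp
    rw [h1, dsum_split (K + 1) (J + 1) (fun _ _ => True) (fun k j => t ≤ k + j)]
    congr 1
    · exact Finset.sum_congr rfl fun k _ => Finset.sum_congr rfl fun j _ => by simp
    · exact Finset.sum_congr rfl fun k _ => Finset.sum_congr rfl fun j _ => by simp only [true_and, not_le]
  have eM : (1 : ℝ) =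
      (∑ k ∈ range (K + 1), ∑ j ∈ range (J + 1), if t ≤ k + j then a k * b j else 0) +
        (∑ k ∈ range (K + 1), ∑ j ∈ range (J + 1), if k + j < t then a k * b j else 0) := by
    have h0 : (1 : ℝ) = ∑ k ∈ range (K + 1), ∑ j ∈ range (J + 1), if True then a k * b j else 0 := by
      simp only [if_true]; rw [← Finset.sum_mul_sum, hA1, hB1, mul_one]
    rw [h0, dsum_split (K + 1) (J + 1) (fun _ _ => True) (fun k j => t ≤ k + j)]
    congr 1
    · exact Finset.sum_congr rfl fun k _ => Finset.sum_congr rfl fun j _ => by simp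
    · exact Finset.sum_congr rfl fun k _ => Finset.sum_congr rfl fun j _ => by simp only [true_and, not_le]
  have eMB : (∑ k ∈ range (K + 1), ∑ j ∈ range (J + 1), if r ≤ k then a k * b j else 0) =
      (∑ k ∈ range (K + 1), ∑ j ∈ range (J + 1), if t ≤ k + j ∧ r ≤ k then a k * b j else 0) +
        (∑ k ∈ range (K + 1), ∑ j ∈ range (J + 1), if r ≤ k ∧ k + j < t then a k * b j else 0) := by
    rw [dsum_split (K + 1) (J + 1) (fun k _ => r ≤ k) (fun k j => t ≤ k + j)]
    congr 1
    · refine Finset.sum_congr rfl fun k _ => Finset.sum_congr rfl fun j _ => ?_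
      by_cases h1 : r ≤ k <;> by_cases h2 : t ≤ k + j <;> simp [h1, h2]
    · refine Finset.sum_congr rfl fun k _ => Finset.sum_congr rfl fun j _ => ?_
      by_cases h1 : r ≤ k <;> by_cases h2 : t ≤ k + j
      all_goals first
        | (have h3 : ¬ k + j < t := by omega
           simp [h1, h2, h3])
        | (have h3 : k + j < t := by omega
           simp [h1, h2, h3])
  have eML : (∑ k ∈ range (K + 1), ∑ j ∈ range (J + 1), if k + j < t then a k * b j else 0) =
      1 - ∑ k ∈ range (K + 1), ∑ j ∈ range (J + 1), if t ≤ k + j then a k * b j else 0 := by linarith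
  rw [eSU, eMB, eML] at hgrid
  rw [eSU, eMB]
  linarith

/-! ## Layer weights sum to one -/

omit [DecidableEq ι] in
/-- `Σ_k μ{N_S = k} = 1`. [folklore] -/
theorem sum_real_layer_eq_one (p : ι → unitInterval) (S : Finset ι) :
    ∑ k ∈ range (S.card + 1), (prodBernoulli p).real {ω' : Set ι | (S.filter (· ∈ ω')).card = k} = 1 := by
  simp_rw [prodBernoulli_real_eq_sum_weight_ind]
  rw [Finset.sum_comm]
  have h1 : ∀ ω : Set ι, ∑ k ∈ range (S.card + 1), weight (fun e => (p e : ℝ)) ω *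
      ind {ω' : Set ι | (S.filter (· ∈ ω')).card = k} ω = weight (fun e => (p e : ℝ)) ω := by
    intro ω
    rw [← Finset.mul_sum]
    have hk₀ : (S.filter (· ∈ ω)).card ∈ range (S.card + 1) :=
      Finset.mem_range.2 (Nat.lt_succ_of_le (Finset.card_filter_le _ _))
    rw [Finset.sum_eq_single_of_mem ((S.filter (· ∈ ω)).card) hk₀
      (f := fun k => ind {ω' : Set ι | (S.filter (· ∈ ω')).card = k} ω)
      (fun k _ hk => ind_of_not_mem fun h => hk (Eq.symm h))]
    rw [ind_of_mem (show ω ∈ {ω' : Set ι | (S.filter (· ∈ ω')).card = (S.filter (· ∈ ω)).card} from rfl), mul_one]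
  rw [Finset.sum_congr rfl fun ω _ => h1 ω]
  exact Literature.Combinatorics.Sahi2008.sum_bernoulliWeight p

/-! ## THEOREM A: `(2′)` for every sub-block threshold -/

/-- **`(2′)` FOR SUB-BLOCK THRESHOLDS.**  For every product measure, every block `F`, every `T ⊆ F`, all `t r : ℕ` and EVERY increasing
event `U`:  `0 ≤ n(1_U, 1_{N_T ≥ r})` for the first slot `H = {N_F ≥ t}`, i.e. `Cov(U,B) ≥ μ(Hᶜ)·Cov(U,B ∣ Hᶜ)` with `B = {N_T ≥ r}`.
[this work] -/
theorem osN_subblockThreshold_nonneg (p : ι → unitInterval) (F : Finset ι) {T : Finset ι} (hTF : T ⊆ F) (t r : ℕ)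
    {U : Set (Set ι)} (hU : IsUpperSet U) :
    0 ≤ osN p {ω : Set ι | t ≤ (F.filter (· ∈ ω)).card} (ind U) (ind {ω : Set ι | r ≤ (T.filter (· ∈ ω)).card}) := by
  set R : Finset ι := F \ T with hR
  have hTR : Disjoint T R := Finset.disjoint_sdiff
  set H : Set (Set ι) := {ω : Set ι | t ≤ (F.filter (· ∈ ω)).card} with hH
  set B : Set (Set ι) := {ω : Set ι | r ≤ (T.filter (· ∈ ω)).card} with hB
  -- grid data
  obtain ⟨a, ha⟩ : ∃ a : ℕ → ℝ, ∀ k, a k = (prodBernoulli p).real {ω' : Set ι | (T.filter (· ∈ ω')).card = k} := ⟨_, fun _ => rfl⟩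
  obtain ⟨b, hb⟩ : ∃ b : ℕ → ℝ, ∀ j, b j = (prodBernoulli p).real {ω' : Set ι | (R.filter (· ∈ ω')).card = j} := ⟨_, fun _ => rfl⟩
  obtain ⟨u, hu⟩ : ∃ u : ℕ → ℕ → ℝ, ∀ k j, u k j = (prodBernoulli p).real
      (U ∩ {ω' : Set ι | (R.filter (· ∈ ω')).card = j} ∩ {ω' : Set ι | (T.filter (· ∈ ω')).card = k}) := ⟨_, fun _ _ => rfl⟩
  have ha0 : ∀ k, 0 ≤ a k := fun k => by rw [ha]; exact measureReal_nonneg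
  have hb0 : ∀ j, 0 ≤ b j := fun j => by rw [hb]; exact measureReal_nonneg
  have hu0 : ∀ k j, 0 ≤ u k j := fun k j => by rw [hu]; exact measureReal_nonneg
  have hcell : ∀ k j, (prodBernoulli p).real (Set.univ ∩ {ω' : Set ι | (R.filter (· ∈ ω')).card = j} ∩
      {ω' : Set ι | (T.filter (· ∈ ω')).card = k}) = a k * b j := fun k j => by
    rw [ha, hb]; exact real_cell_eq_mul p hTR k j
  have hub : ∀ k j, u k j ≤ a k * b j := fun k j => by
    rw [hu, ← hcell]
    exact measureReal_mono (Set.inter_subset_inter_left _ (Set.inter_subset_inter_left _ (Set.subset_univ U)))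
  have F1 : ∀ k k' j, k ≤ k' → u k j * a k' ≤ u k' j * a k := fun k k' j hkk' => by
    rw [hu, hu, ha, ha]
    exact real_inter_inter_layer_mul_le p T hU
      ((determinedBy_layer R j).mono (fun i hi => Finset.disjoint_left.1 hTR.symm (Finset.mem_coe.1 hi))) hkk'
  have F2 : ∀ k j j', j ≤ j' → u k j * b j' ≤ u k j' * b j := fun k j j' hjj' => by
    rw [hu, hu, hb, hb, Set.inter_right_comm U, Set.inter_right_comm U _ {ω' : Set ι | (T.filter (· ∈ ω')).card = k}]
    exact real_inter_inter_layer_mul_le p R hU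
      ((determinedBy_layer T k).mono (fun i hi => Finset.disjoint_left.1 hTR (Finset.mem_coe.1 hi))) hjj'
  have hA1 : ∑ k ∈ range (T.card + 1), a k = 1 := by
    rw [Finset.sum_congr rfl fun k _ => ha k]; exact sum_real_layer_eq_one p T
  have hB1 : ∑ j ∈ range (R.card + 1), b j = 1 := by
    rw [Finset.sum_congr rfl fun j _ => hb j]; exact sum_real_layer_eq_one p R
  have hgrid := grid_osN_nonneg_Hform T.card R.card a b u r t ha0 hb0 hu0 hub F1 F2 hA1 hB1
  -- membership in `H`, `B` on a cell
  have memH : ∀ ω : Set ι, ∀ k j, (T.filter (· ∈ ω)).card = k → (R.filter (· ∈ ω)).card = j → (ω ∈ H ↔ t ≤ k + j) := by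
    intro ω k j hk hj
    rw [hH, Set.mem_setOf_eq, card_filter_mem_eq_add F hTF ω, hk, ← hR, hj]
  have memB : ∀ ω : Set ι, ∀ k, (T.filter (· ∈ ω)).card = k → (ω ∈ B ↔ r ≤ k) := by
    intro ω k hk
    rw [hB, Set.mem_setOf_eq, hk]
  -- the six measures as grid sums
  have eHU : (prodBernoulli p).real (H ∩ U) = ∑ k ∈ range (T.card + 1), ∑ j ∈ range (R.card + 1),
      if t ≤ k + j then u k j else 0 := by
    rw [real_eq_sum_cells p T R]
    refine Finset.sum_congr rfl fun k _ => Finset.sum_congr rfl fun j _ => ?_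
    rw [hu]
    exact real_inter_cell_eq_ite p T R (C := H ∩ U) (V := U) (P := t ≤ k + j) fun ω hk hj => by
      rw [Set.mem_inter_iff, memH ω k j hk hj]
  have eHB : (prodBernoulli p).real (H ∩ B) = ∑ k ∈ range (T.card + 1), ∑ j ∈ range (R.card + 1),
      if t ≤ k + j ∧ r ≤ k then a k * b j else 0 := by
    rw [real_eq_sum_cells p T R]
    refine Finset.sum_congr rfl fun k _ => Finset.sum_congr rfl fun j _ => ?_
    rw [← hcell]
    exact real_inter_cell_eq_ite p T R (C := H ∩ B) (V := Set.univ) (P := t ≤ k + j ∧ r ≤ k) fun ω hk hj => by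
      rw [Set.mem_inter_iff, memH ω k j hk hj, memB ω k hk]; simp
  have eH : (prodBernoulli p).real H = ∑ k ∈ range (T.card + 1), ∑ j ∈ range (R.card + 1),
      if t ≤ k + j then a k * b j else 0 := by
    rw [real_eq_sum_cells p T R]
    refine Finset.sum_congr rfl fun k _ => Finset.sum_congr rfl fun j _ => ?_
    rw [← hcell]
    exact real_inter_cell_eq_ite p T R (C := H) (V := Set.univ) (P := t ≤ k + j) fun ω hk hj => by
      rw [memH ω k j hk hj]; simp
  have eHUB : (prodBernoulli p).real (H ∩ U ∩ B) = ∑ k ∈ range (T.card + 1), ∑ j ∈ range (R.card + 1),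
      if t ≤ k + j ∧ r ≤ k then u k j else 0 := by
    rw [real_eq_sum_cells p T R]
    refine Finset.sum_congr rfl fun k _ => Finset.sum_congr rfl fun j _ => ?_
    rw [hu]
    exact real_inter_cell_eq_ite p T R (C := H ∩ U ∩ B) (V := U) (P := t ≤ k + j ∧ r ≤ k) fun ω hk hj => by
      rw [Set.mem_inter_iff, Set.mem_inter_iff, memH ω k j hk hj, memB ω k hk]; tauto
  have eU : (prodBernoulli p).real U = ∑ k ∈ range (T.card + 1), ∑ j ∈ range (R.card + 1), u k j := by
    rw [real_eq_sum_cells p T R]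
    exact Finset.sum_congr rfl fun k _ => Finset.sum_congr rfl fun j _ => (hu k j).symm
  have eB : (prodBernoulli p).real B = ∑ k ∈ range (T.card + 1), ∑ j ∈ range (R.card + 1),
      if r ≤ k then a k * b j else 0 := by
    rw [real_eq_sum_cells p T R]
    refine Finset.sum_congr rfl fun k _ => Finset.sum_congr rfl fun j _ => ?_
    rw [← hcell]
    exact real_inter_cell_eq_ite p T R (C := B) (V := Set.univ) (P := r ≤ k) fun ω hk hj => by
      rw [memB ω k hk]; simp
  rw [osN_ind_ind, eHU, eHB, eH, eHUB, eU, eB]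
  exact hgrid

/-- **KAHN C5 / SAHI `C₃` FOR TWO NESTED-BLOCK THRESHOLDS AND AN ARBITRARY THIRD EVENT.**  For every product measure, all
`T ⊆ F`, all `t r : ℕ` and every increasing `U`:  `0 ≤ E₃(1_{N_F ≥ t}, 1_U, 1_{N_T ≥ r})`. [this work] -/
theorem sahiE3_threshold_subblockThreshold_nonneg (p : ι → unitInterval) (F : Finset ι) {T : Finset ι} (hTF : T ⊆ F) (t r : ℕ)
    {U : Set (Set ι)} (hU : IsUpperSet U) :
    0 ≤ sahiE3 (prodBernoulli p) {ω : Set ι | t ≤ (F.filter (· ∈ ω)).card} U {ω : Set ι | r ≤ (T.filter (· ∈ ω)).card} := by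
  have hB : IsUpperSet {ω : Set ι | r ≤ (T.filter (· ∈ ω)).card} := by
    intro ω ω' hle hω
    simp only [Set.mem_setOf_eq] at hω ⊢
    refine hω.trans (Finset.card_le_card fun i hi => ?_)
    rw [Finset.mem_filter] at hi ⊢
    exact ⟨hi.1, hle hi.2⟩
  rw [← osT_ind_ind, osT_eq_osMp_add_osN]
  exact add_nonneg (osMp_threshold_nonneg_all p F t hU hB) (osN_subblockThreshold_nonneg p F hTF t r hU)

/-- The same with the two slots exchanged (`osN` is symmetric). [this work] -/
theorem osN_subblockThreshold_nonneg' (p : ι → unitInterval) (F : Finset ι) {T : Finset ι} (hTF : T ⊆ F) (t r : ℕ)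
    {U : Set (Set ι)} (hU : IsUpperSet U) :
    0 ≤ osN p {ω : Set ι | t ≤ (F.filter (· ∈ ω)).card} (ind {ω : Set ι | r ≤ (T.filter (· ∈ ω)).card}) (ind U) := by
  rw [osN_comm]; exact osN_subblockThreshold_nonneg p F hTF t r hU

/-- **KAHN C5 / SAHI `C₃`**, slots exchanged: `0 ≤ E₃(1_{N_F ≥ t}, 1_{N_T ≥ r}, 1_U)`. [this work] -/
theorem sahiE3_threshold_subblockThreshold_nonneg' (p : ι → unitInterval) (F : Finset ι) {T : Finset ι} (hTF : T ⊆ F) (t r : ℕ)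
    {U : Set (Set ι)} (hU : IsUpperSet U) :
    0 ≤ sahiE3 (prodBernoulli p) {ω : Set ι | t ≤ (F.filter (· ∈ ω)).card} {ω : Set ι | r ≤ (T.filter (· ∈ ω)).card} U := by
  have hB : IsUpperSet {ω : Set ι | r ≤ (T.filter (· ∈ ω)).card} := by
    intro ω ω' hle hω
    simp only [Set.mem_setOf_eq] at hω ⊢
    refine hω.trans (Finset.card_le_card fun i hi => ?_)
    rw [Finset.mem_filter] at hi ⊢
    exact ⟨hi.1, hle hi.2⟩
  rw [← osT_ind_ind, osT_eq_osMp_add_osN]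
  exact add_nonneg (osMp_threshold_nonneg_all p F t hB hU) (osN_subblockThreshold_nonneg' p F hTF t r hU)

end SahiOneStep

end Summit.CriticalPhenomena.PercolationContinuityZ3.Theorems
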